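import Mathlib
import Summits.Ventures.PercRepro2.Defs
import Summits.Ventures.PercRepro2.Independence
import Summits.Ventures.PercRepro2.Harris
import Summits.Ventures.PercRepro2.Graph
import Summits.Ventures.PercRepro2.Exploration
import Summits.Ventures.PercRepro2.Events
import Summits.Ventures.PercRepro2.Induced
import Summits.Ventures.PercRepro2.BHKEvents
import Summits.Ventures.PercRepro2.BHKAvoid
import Summits.Ventures.PercRepro2.ZCPendantSecondOrder
import Summits.Ventures.PercRepro2.CDRequired
import Summits.Ventures.PercRepro2.CCTRootEdge
import Summits.Ventures.PercRepro2.OneEdge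
import Summits.Ventures.PercRepro2.OneRootDropMono
import Summits.Ventures.PercRepro2.AvoidMono
import Summits.Ventures.PercRepro2.CDAvoidAnti
import Summits.Ventures.PercRepro2.CDNestedEdgeLemmas

/-!
# The first nested pair of routes — the two cross-world monotonicities (blind cell PercRepro2,
mine-a g34; MINE-A.md §89.7, proofs/MINEA-CD-NESTED.md §2 (B))

For the worlds `p[ε ↦ 1]` (the edge `ε = {a₁, a₃}` open) and `p[ε ↦ 0, b₁ ↦ 1, b₂ ↦ 1]` (the path
`a₁ – y – a₃` open, `ε` closed): pinning `b₁` and then `b₂` open raises `P(U ∣ Q)` (`beta_mono`: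
`AvoidMono.avoid_mono` twice, with the avoided set growing `{a₁, a₃} → {a₁, a₃, y}`) and lowers
`P(o ∈ C₂ ∣ Q)` (`gamma_anti`: `CDAvoidAnti.avoid_anti` twice); once `b₁, b₂` are open the edge `ε` is
internal and its state is irrelevant (`CDNestedEdge.conn_update_ε_iff`).  Both in cleared form, with the
degenerate cases `P(Q) = 0` handled separately.  No definition; one seat.
-/

namespace Summit.Ventures.PercRepro2

namespace CDNestedEdge

section Main

variable {V : Type*} {E : Type*} [Fintype E] [DecidableEq E] [Fintype V] [DecidableEq V]
  {R : Type*} [Field R] [LinearOrder R] [IsStrictOrderedRing R]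

variable {ends : E → Sym2 V} {ε b₁ b₂ : E} {a₁ a₃ y : V}

/-- **The `β`-monotonicity of the two worlds**: pinning `b₁` and `b₂` open (from the world with `ε`
open) raises `P(U ∣ Q)`: `P_{p[ε↦1]}(Q U) · P_{p₂}(Q) ≤ P_{p₂}(Q U) · P_{p[ε↦1]}(Q)` with
`p₂ = p[ε↦0, b₁↦1, b₂↦1]`. -/
theorem beta_mono (p : E → R) (hp : IsProbVec p) (hε : ends ε = s(a₁, a₃))
    (hb₁ : ends b₁ = s(a₁, y)) (hb₂ : ends b₂ = s(y, a₃)) (h1 : b₁ ≠ ε) (h2 : b₂ ≠ ε)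
    (h12 : b₂ ≠ b₁) (a₂ : V) {𝓔 : Set (Set V)} (h𝓔 : IsUpperSet 𝓔) :
    prob (Function.update p ε 1) ((connEvent ends a₁ a₂)ᶜ ∩ clusterInEvent ends a₁ 𝓔) *
        prob (Function.update (Function.update (Function.update p ε 0) b₁ 1) b₂ 1)
          (connEvent ends a₁ a₂)ᶜ ≤
      prob (Function.update (Function.update (Function.update p ε 0) b₁ 1) b₂ 1)
          ((connEvent ends a₁ a₂)ᶜ ∩ clusterInEvent ends a₁ 𝓔) *
        prob (Function.update p ε 1) (connEvent ends a₁ a₂)ᶜ := by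
  set q₁ := Function.update p ε 1 with hq₁
  set q₂ := Function.update q₁ b₁ 1 with hq₂
  set q₃ := Function.update q₂ b₂ 1 with hq₃
  set p₂ := Function.update (Function.update (Function.update p ε 0) b₁ 1) b₂ 1 with hp₂
  set Q := (connEvent ends a₁ a₂)ᶜ with hQ
  set U := clusterInEvent ends a₁ 𝓔 with hU
  set S : Finset V := {a₁, a₃} with hS
  set S' : Finset V := {a₁, a₃, y} with hS'
  have hq₁p : IsProbVec q₁ := hp.update ε zero_le_one le_rfl
  have hq₂p : IsProbVec q₂ := hq₁p.update b₁ zero_le_one le_rfl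
  have hq₃p : IsProbVec q₃ := hq₂p.update b₂ zero_le_one le_rfl
  have hp₂p : IsProbVec p₂ :=
    ((hp.update ε le_rfl zero_le_one).update b₁ zero_le_one le_rfl).update b₂ zero_le_one le_rfl
  -- (c1) under `q₁`, `Q` is the avoidance of `S`
  have c1 : ∀ X : Set (Config E), prob q₁ (X ∩ Q) = prob q₁ (X ∩ avoidAll ends a₂ S) := by
    intro X
    rw [hq₁, CCT.prob_update_one_eq, CCT.prob_update_one_eq]
    congr 1
    ext ω
    simp only [Set.mem_setOf_eq, Set.mem_inter_iff, hQ, Set.mem_compl_iff, mem_connEvent]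
    rw [Q_iff_avoid_pair hε a₂ _ (Function.update_self ε true ω)]
  have c1' : prob q₁ Q = prob q₁ (avoidAll ends a₂ S) := by
    have := c1 Set.univ
    simpa using this
  -- (c2) under `q₂`, avoiding `S` is avoiding `S'`
  have c2 : ∀ X : Set (Config E),
      prob q₂ (X ∩ avoidAll ends a₂ S) = prob q₂ (X ∩ avoidAll ends a₂ S') := by
    intro X
    rw [hq₂, hq₁, prob_update_two_eq, prob_update_two_eq]
    congr 1
    ext ω
    simp only [Set.mem_setOf_eq, Set.mem_inter_iff]
    have hωε : Function.update (Function.update ω ε true) b₁ true ε = true := by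
      rw [Function.update_of_ne h1.symm, Function.update_self]
    have hωb : Function.update (Function.update ω ε true) b₁ true b₁ = true := Function.update_self _ _ _
    rw [← Q_iff_avoid_pair hε a₂ _ hωε, ← Q_iff_avoid_triple hε hb₁ a₂ _ hωε hωb]
  have c2' : prob q₂ (avoidAll ends a₂ S) = prob q₂ (avoidAll ends a₂ S') := by
    have := c2 Set.univ
    simpa using this
  -- (c3) under `q₃`, avoiding `S'` is `Q`
  have c3 : ∀ X : Set (Config E), prob q₃ (X ∩ avoidAll ends a₂ S') = prob q₃ (X ∩ Q) := by
    intro X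
    rw [hq₃, hq₂, hq₁, prob_update_three_eq, prob_update_three_eq]
    congr 1
    ext ω
    simp only [Set.mem_setOf_eq, Set.mem_inter_iff, hQ, Set.mem_compl_iff, mem_connEvent]
    have hωε : Function.update (Function.update (Function.update ω ε true) b₁ true) b₂ true ε =
        true := by
      rw [Function.update_of_ne h2.symm, Function.update_of_ne h1.symm, Function.update_self]
    have hωb : Function.update (Function.update (Function.update ω ε true) b₁ true) b₂ true b₁ =
        true := by
      rw [Function.update_of_ne h12.symm, Function.update_self]
    rw [Q_iff_avoid_triple hε hb₁ a₂ _ hωε hωb]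
  have c3' : prob q₃ (avoidAll ends a₂ S') = prob q₃ Q := by
    have := c3 Set.univ
    simpa using this
  -- (c4) `q₃` and `p₂` agree on `Q`-events: `ε` is internal once `b₁, b₂` are open
  have c4 : ∀ X : Set (Config E), (∀ ω, (∀ u w, Conn ends (Function.update ω ε true) u w ↔
      Conn ends (Function.update ω ε false) u w) →
      (Function.update ω ε true ∈ X ↔ Function.update ω ε false ∈ X)) →
      prob q₃ X = prob p₂ X := by
    intro X hX
    rw [hq₃, hq₂, hq₁, hp₂, prob_update_three_eq, prob_update_zero_two_eq]
    congr 1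
    ext ω
    simp only [Set.mem_setOf_eq]
    have e1 : Function.update (Function.update (Function.update ω ε true) b₁ true) b₂ true =
        Function.update (Function.update (Function.update ω b₁ true) b₂ true) ε true := by
      rw [Function.update_comm h1.symm true true ω,
        Function.update_comm h2.symm true true (Function.update ω b₁ true)]
    have e2 : Function.update (Function.update (Function.update ω ε false) b₁ true) b₂ true =
        Function.update (Function.update (Function.update ω b₁ true) b₂ true) ε false := by
      rw [Function.update_comm h1.symm false true ω,
        Function.update_comm h2.symm false true (Function.update ω b₁ true)]
    rw [e1, e2]
    apply hX
    exact conn_update_ε_iff hε hb₁ hb₂ h1 h2 _ (by rw [Function.update_of_ne h12.symm]; simp) (by simp)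
  have c4Q : prob q₃ Q = prob p₂ Q := by
    refine c4 Q fun ω hc => ?_
    simp only [hQ, Set.mem_compl_iff, mem_connEvent, hc]
  have c4QU : prob q₃ (Q ∩ U) = prob p₂ (Q ∩ U) := by
    refine c4 (Q ∩ U) fun ω hc => ?_
    have hcl := cluster_eq_of_conn_iff hc a₁
    simp only [Set.mem_inter_iff, hQ, Set.mem_compl_iff, mem_connEvent, hU, mem_clusterInEvent, hc,
      hcl]
  have c4QU' : prob q₃ (U ∩ Q) = prob p₂ (U ∩ Q) := by
    rw [Set.inter_comm U Q]; exact c4QU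
  -- the cleared inequality; trivial cases first
  have hQ₁0 : 0 ≤ prob q₁ Q := prob_nonneg hq₁p _
  have hQ₂0 : 0 ≤ prob p₂ Q := prob_nonneg hp₂p _
  rcases hQ₁0.lt_or_eq with hD₁ | hD₁
  · rcases hQ₂0.lt_or_eq with hD₂ | hD₂
    · -- both conditioning probabilities are positive: the ratio chain
      have r1 : prob q₁ (U ∩ avoidAll ends a₂ S) / prob q₁ (avoidAll ends a₂ S) ≤
          prob q₂ (U ∩ avoidAll ends a₂ S) / prob q₂ (avoidAll ends a₂ S) := by
        have hs : 0 < prob (Function.update q₁ b₁ (q₁ b₁)) (avoidAll ends a₂ S) := by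
          rw [Function.update_eq_self, ← c1']; exact hD₁
        have ht : 0 < prob (Function.update q₁ b₁ 1) (avoidAll ends a₂ S) := by
          rw [← hq₂, c2']
          calc (0 : R) < prob p₂ Q := hD₂
            _ = prob q₃ Q := c4Q.symm
            _ = prob q₃ (avoidAll ends a₂ S') := c3'.symm
            _ ≤ prob q₂ (avoidAll ends a₂ S') := by
                rw [hq₃]; exact prob_update_one_avoid_le q₂ hq₂p b₂ a₂ S'
        have key := AvoidMono.avoid_mono q₁ ends hq₁p hb₁ a₁ a₂ (S := S) (by simp [hS]) (by simp [hS])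
          h𝓔 (s := q₁ b₁) (t := 1) (hq₁p.le_one b₁) hs ht
        rwa [Function.update_eq_self] at key
      have r2 : prob q₂ (U ∩ avoidAll ends a₂ S') / prob q₂ (avoidAll ends a₂ S') ≤
          prob q₃ (U ∩ avoidAll ends a₂ S') / prob q₃ (avoidAll ends a₂ S') := by
        have ht : 0 < prob (Function.update q₂ b₂ 1) (avoidAll ends a₂ S') := by
          rw [← hq₃, c3', c4Q]; exact hD₂
        have hs : 0 < prob (Function.update q₂ b₂ (q₂ b₂)) (avoidAll ends a₂ S') := by
          rw [Function.update_eq_self]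
          calc (0 : R) < prob (Function.update q₂ b₂ 1) (avoidAll ends a₂ S') := ht
            _ ≤ prob q₂ (avoidAll ends a₂ S') := prob_update_one_avoid_le q₂ hq₂p b₂ a₂ S'
        have key := AvoidMono.avoid_mono q₂ ends hq₂p hb₂ a₁ a₂ (S := S') (by simp [hS']) (by simp [hS'])
          h𝓔 (s := q₂ b₂) (t := 1) (hq₂p.le_one b₂) hs ht
        rwa [Function.update_eq_self] at key
      have hchain : prob q₁ (U ∩ Q) / prob q₁ Q ≤ prob p₂ (U ∩ Q) / prob p₂ Q := by
        rw [c1 U, c1', ← c4QU', ← c4Q, ← c3 U, ← c3']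
        calc prob q₁ (U ∩ avoidAll ends a₂ S) / prob q₁ (avoidAll ends a₂ S)
            ≤ prob q₂ (U ∩ avoidAll ends a₂ S) / prob q₂ (avoidAll ends a₂ S) := r1
          _ = prob q₂ (U ∩ avoidAll ends a₂ S') / prob q₂ (avoidAll ends a₂ S') := by
              rw [c2 U, c2']
          _ ≤ prob q₃ (U ∩ avoidAll ends a₂ S') / prob q₃ (avoidAll ends a₂ S') := r2
      rw [div_le_div_iff₀ hD₁ hD₂] at hchain
      rw [Set.inter_comm Q U]
      linarith [hchain]
    · -- `P_{p₂}(Q) = 0`: both sides vanish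
      rw [← hD₂]
      have h0 : prob p₂ (Q ∩ U) = 0 :=
        le_antisymm (hD₂ ▸ prob_mono hp₂p Set.inter_subset_left) (prob_nonneg hp₂p _)
      rw [h0]
      simp
  · -- `P_{q₁}(Q) = 0`: the left side vanishes
    have h0 : prob q₁ (Q ∩ U) = 0 :=
      le_antisymm (hD₁ ▸ prob_mono hq₁p Set.inter_subset_left) (prob_nonneg hq₁p _)
    rw [h0, ← hD₁]
    simp

/-- **The `γ`-anti-monotonicity of the two worlds**: pinning `b₁` and `b₂` open (from the world with
`ε` open) lowers `P(o ∈ C₂ ∣ Q)`: `P_{p₂}(Q f) · P_{p[ε↦1]}(Q) ≤ P_{p[ε↦1]}(Q f) · P_{p₂}(Q)` with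
`p₂ = p[ε↦0, b₁↦1, b₂↦1]`. -/
theorem gamma_anti (p : E → R) (hp : IsProbVec p) (hε : ends ε = s(a₁, a₃))
    (hb₁ : ends b₁ = s(a₁, y)) (hb₂ : ends b₂ = s(y, a₃)) (h1 : b₁ ≠ ε) (h2 : b₂ ≠ ε)
    (h12 : b₂ ≠ b₁) (a₂ o : V) :
    prob (Function.update (Function.update (Function.update p ε 0) b₁ 1) b₂ 1)
          ((connEvent ends a₁ a₂)ᶜ ∩ connEvent ends a₂ o) *
        prob (Function.update p ε 1) (connEvent ends a₁ a₂)ᶜ ≤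
      prob (Function.update p ε 1) ((connEvent ends a₁ a₂)ᶜ ∩ connEvent ends a₂ o) *
        prob (Function.update (Function.update (Function.update p ε 0) b₁ 1) b₂ 1)
          (connEvent ends a₁ a₂)ᶜ := by
  set q₁ := Function.update p ε 1 with hq₁
  set q₂ := Function.update q₁ b₁ 1 with hq₂
  set q₃ := Function.update q₂ b₂ 1 with hq₃
  set p₂ := Function.update (Function.update (Function.update p ε 0) b₁ 1) b₂ 1 with hp₂
  set Q := (connEvent ends a₁ a₂)ᶜ with hQ
  set f := connEvent ends a₂ o with hf
  set S : Finset V := {a₁, a₃} with hS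
  set S' : Finset V := {a₁, a₃, y} with hS'
  have hq₁p : IsProbVec q₁ := hp.update ε zero_le_one le_rfl
  have hq₂p : IsProbVec q₂ := hq₁p.update b₁ zero_le_one le_rfl
  have hq₃p : IsProbVec q₃ := hq₂p.update b₂ zero_le_one le_rfl
  have hp₂p : IsProbVec p₂ :=
    ((hp.update ε le_rfl zero_le_one).update b₁ zero_le_one le_rfl).update b₂ zero_le_one le_rfl
  have c1 : ∀ X : Set (Config E), prob q₁ (X ∩ Q) = prob q₁ (X ∩ avoidAll ends a₂ S) := by
    intro X
    rw [hq₁, CCT.prob_update_one_eq, CCT.prob_update_one_eq]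
    congr 1
    ext ω
    simp only [Set.mem_setOf_eq, Set.mem_inter_iff, hQ, Set.mem_compl_iff, mem_connEvent]
    rw [Q_iff_avoid_pair hε a₂ _ (Function.update_self ε true ω)]
  have c1' : prob q₁ Q = prob q₁ (avoidAll ends a₂ S) := by
    have := c1 Set.univ
    simpa using this
  have c2 : ∀ X : Set (Config E),
      prob q₂ (X ∩ avoidAll ends a₂ S) = prob q₂ (X ∩ avoidAll ends a₂ S') := by
    intro X
    rw [hq₂, hq₁, prob_update_two_eq, prob_update_two_eq]
    congr 1
    ext ω
    simp only [Set.mem_setOf_eq, Set.mem_inter_iff]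
    have hωε : Function.update (Function.update ω ε true) b₁ true ε = true := by
      rw [Function.update_of_ne h1.symm, Function.update_self]
    have hωb : Function.update (Function.update ω ε true) b₁ true b₁ = true := Function.update_self _ _ _
    rw [← Q_iff_avoid_pair hε a₂ _ hωε, ← Q_iff_avoid_triple hε hb₁ a₂ _ hωε hωb]
  have c2' : prob q₂ (avoidAll ends a₂ S) = prob q₂ (avoidAll ends a₂ S') := by
    have := c2 Set.univ
    simpa using this
  have c3 : ∀ X : Set (Config E), prob q₃ (X ∩ avoidAll ends a₂ S') = prob q₃ (X ∩ Q) := by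
    intro X
    rw [hq₃, hq₂, hq₁, prob_update_three_eq, prob_update_three_eq]
    congr 1
    ext ω
    simp only [Set.mem_setOf_eq, Set.mem_inter_iff, hQ, Set.mem_compl_iff, mem_connEvent]
    have hωε : Function.update (Function.update (Function.update ω ε true) b₁ true) b₂ true ε =
        true := by
      rw [Function.update_of_ne h2.symm, Function.update_of_ne h1.symm, Function.update_self]
    have hωb : Function.update (Function.update (Function.update ω ε true) b₁ true) b₂ true b₁ =
        true := by
      rw [Function.update_of_ne h12.symm, Function.update_self]
    rw [Q_iff_avoid_triple hε hb₁ a₂ _ hωε hωb]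
  have c3' : prob q₃ (avoidAll ends a₂ S') = prob q₃ Q := by
    have := c3 Set.univ
    simpa using this
  have c4 : ∀ X : Set (Config E), (∀ ω, (∀ u w, Conn ends (Function.update ω ε true) u w ↔
      Conn ends (Function.update ω ε false) u w) →
      (Function.update ω ε true ∈ X ↔ Function.update ω ε false ∈ X)) →
      prob q₃ X = prob p₂ X := by
    intro X hX
    rw [hq₃, hq₂, hq₁, hp₂, prob_update_three_eq, prob_update_zero_two_eq]
    congr 1
    ext ω
    simp only [Set.mem_setOf_eq]
    have e1 : Function.update (Function.update (Function.update ω ε true) b₁ true) b₂ true =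
        Function.update (Function.update (Function.update ω b₁ true) b₂ true) ε true := by
      rw [Function.update_comm h1.symm true true ω,
        Function.update_comm h2.symm true true (Function.update ω b₁ true)]
    have e2 : Function.update (Function.update (Function.update ω ε false) b₁ true) b₂ true =
        Function.update (Function.update (Function.update ω b₁ true) b₂ true) ε false := by
      rw [Function.update_comm h1.symm false true ω,
        Function.update_comm h2.symm false true (Function.update ω b₁ true)]
    rw [e1, e2]
    apply hX
    exact conn_update_ε_iff hε hb₁ hb₂ h1 h2 _ (by rw [Function.update_of_ne h12.symm]; simp) (by simp)
  have c4Q : prob q₃ Q = prob p₂ Q := by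
    refine c4 Q fun ω hc => ?_
    simp only [hQ, Set.mem_compl_iff, mem_connEvent, hc]
  have c4Qf : prob q₃ (f ∩ Q) = prob p₂ (f ∩ Q) := by
    refine c4 (f ∩ Q) fun ω hc => ?_
    simp only [Set.mem_inter_iff, hQ, Set.mem_compl_iff, mem_connEvent, hf, hc]
  have hQ₁0 : 0 ≤ prob q₁ Q := prob_nonneg hq₁p _
  have hQ₂0 : 0 ≤ prob p₂ Q := prob_nonneg hp₂p _
  rcases hQ₁0.lt_or_eq with hD₁ | hD₁
  · rcases hQ₂0.lt_or_eq with hD₂ | hD₂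
    · have r1 : prob q₂ (f ∩ avoidAll ends a₂ S) / prob q₂ (avoidAll ends a₂ S) ≤
          prob q₁ (f ∩ avoidAll ends a₂ S) / prob q₁ (avoidAll ends a₂ S) := by
        have hs : 0 < prob (Function.update q₁ b₁ (q₁ b₁)) (avoidAll ends a₂ S) := by
          rw [Function.update_eq_self, ← c1']; exact hD₁
        have ht : 0 < prob (Function.update q₁ b₁ 1) (avoidAll ends a₂ S) := by
          rw [← hq₂, c2']
          calc (0 : R) < prob p₂ Q := hD₂
            _ = prob q₃ Q := c4Q.symm
            _ = prob q₃ (avoidAll ends a₂ S') := c3'.symm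
            _ ≤ prob q₂ (avoidAll ends a₂ S') := by
                rw [hq₃]; exact prob_update_one_avoid_le q₂ hq₂p b₂ a₂ S'
        have key := CDAvoidAnti.avoid_anti q₁ hq₁p hb₁ a₂ o (S := S) (by simp [hS])
          (s := q₁ b₁) (t := 1) (hq₁p.le_one b₁) hs ht
        rwa [Function.update_eq_self] at key
      have r2 : prob q₃ (f ∩ avoidAll ends a₂ S') / prob q₃ (avoidAll ends a₂ S') ≤
          prob q₂ (f ∩ avoidAll ends a₂ S') / prob q₂ (avoidAll ends a₂ S') := by
        have ht : 0 < prob (Function.update q₂ b₂ 1) (avoidAll ends a₂ S') := by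
          rw [← hq₃, c3', c4Q]; exact hD₂
        have hs : 0 < prob (Function.update q₂ b₂ (q₂ b₂)) (avoidAll ends a₂ S') := by
          rw [Function.update_eq_self]
          calc (0 : R) < prob (Function.update q₂ b₂ 1) (avoidAll ends a₂ S') := ht
            _ ≤ prob q₂ (avoidAll ends a₂ S') := prob_update_one_avoid_le q₂ hq₂p b₂ a₂ S'
        have key := CDAvoidAnti.avoid_anti q₂ hq₂p hb₂ a₂ o (S := S') (by simp [hS'])
          (s := q₂ b₂) (t := 1) (hq₂p.le_one b₂) hs ht
        rwa [Function.update_eq_self] at key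
      have hchain : prob p₂ (f ∩ Q) / prob p₂ Q ≤ prob q₁ (f ∩ Q) / prob q₁ Q := by
        rw [c1 f, c1', ← c4Qf, ← c4Q, ← c3 f, ← c3']
        calc prob q₃ (f ∩ avoidAll ends a₂ S') / prob q₃ (avoidAll ends a₂ S')
            ≤ prob q₂ (f ∩ avoidAll ends a₂ S') / prob q₂ (avoidAll ends a₂ S') := r2
          _ = prob q₂ (f ∩ avoidAll ends a₂ S) / prob q₂ (avoidAll ends a₂ S) := by
              rw [c2 f, c2']
          _ ≤ prob q₁ (f ∩ avoidAll ends a₂ S) / prob q₁ (avoidAll ends a₂ S) := r1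
      rw [div_le_div_iff₀ hD₂ hD₁] at hchain
      rw [Set.inter_comm Q f]
      linarith [hchain]
    · rw [← hD₂]
      have h0 : prob p₂ (Q ∩ f) = 0 :=
        le_antisymm (hD₂ ▸ prob_mono hp₂p Set.inter_subset_left) (prob_nonneg hp₂p _)
      rw [h0]
      simp
  · have h0 : prob q₁ (Q ∩ f) = 0 :=
      le_antisymm (hD₁ ▸ prob_mono hq₁p Set.inter_subset_left) (prob_nonneg hq₁p _)
    rw [h0, ← hD₁]
    simp

end Main

end CDNestedEdge

end Summit.Ventures.PercRepro2
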